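import Literature.Algebra.Lie.OrthogonalAlgebraSimple
import HarnessLib

/-!
# The traceless self-adjoint matrices `𝔤_+` of a split even orthogonal form are an IRREDUCIBLE `𝔬(2l)`-module (Looijenga–Lunts 1997, Appendix (7.5): "The summands are irreducible" — the summand `𝔤_+(U)`, orthogonal case, in matrices)

Topic `Literature/Algebra/Lie` (namespace `Literature.Algebra.Lie.OrthogonalSelfAdjointTypeD`).  Lane `lit-hodgefound`
(Track 2 foundations library), Layer A1, skeleton seat `lit-hodgefound-skel-1` (generation 50), row **A1-174** (§1–§7)
and its ADD-ONLY rider **A1-175** (§8, basis-free transport) of `run/shared/lean/pub/lit-hodgefound/SKELETON.md` —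
successor pointer (b) of generation 49 ("irreducibility of `𝔤_+(U)`
(traceless self-adjoint part) … show every non-zero `ad(𝔞𝔲𝔱)`-stable `P ∋` some `t_{x,x}` (isotropic `x`), then
generate").  THEOREMS ONLY about Mathlib objects (`LieAlgebra.Orthogonal.typeD l K = 𝔬(2l, K)` for `JD l K = (0 I; I 0)`,
`Matrix.IsSelfAdjoint`, `selfAdjointMatricesSubmodule`, `Matrix.trace` / `Matrix.traceLinearMap`, `Matrix.single`); no
definition, no named fact, no `sorry` (net debt `0`); no instance, no notation.  Companion of rows A1-168/169
(`OrthogonalSimpleTypeD.lean`: `𝔬(2l)` itself — the summand `𝔤_-` — is simple), whose matrix-unit calculus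
(`nsub_mul_mul_nsub`, `psub_mul_mul_psub`, `comm_comm_eq_of_mul_self_eq_zero`, the memberships of Humphreys' basis) is
imported and reused, and of row A1-171/172 (`OrthogonalAlgebraSimple.lean`, imported for §8: hyperbolic bases and the
transport pattern).

## Source, VERBATIM (held TeX `paper:arxiv-alg-geom_9604014`, p0028 L80–L94)

> "Let `U` be vector space of finite dimension `≥ 2` with a nondegenerate `ε`-symmetric form and denote its Lie algebra
> of infinitesimal automorphisms by `𝔞𝔲𝔱(U)`. Let `𝔤_±(U)` be the set of `x ∈ 𝔰𝔩(U)` satisfying `⟨xu, u'⟩ = ±⟨u, xu'⟩`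
> and let `𝔤_0(U)` denote the scalar operators in `𝔤𝔩(U)`.  (7.5) Lemma. Suppose that `U` is not an inner product space
> of dimension two. Then `𝔤𝔩_-(U) = 𝔞𝔲𝔱(U)` and `𝔤𝔩(U) = 𝔤_-(U) ⊕ 𝔤_0(U) ⊕ 𝔤_+(U)` is an `𝔞𝔲𝔱(U)`-invariant
> decomposition. The summands are irreducible, except when `U` is an inner product space of dimension `4`. […]
> Proof. The first statements are well-known."

Here: `U = K^{l ⊕ l}` with the split symmetric form `s = JD l K = (0 I; I 0)` (Humphreys' form of `D_ℓ`, [Humphreys1972,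
§1.2 p. 4]); `𝔞𝔲𝔱(U) = 𝔬(2l, K) = typeD l K`; `𝔤_+(U) = {X : Xᵀs = sX, tr X = 0} = selfAdjointMatricesSubmodule s ⊓ ker tr`
— the `(A B; C Aᵀ)` with `B`, `C` symmetric and `tr A = 0` (`fromBlocks_isSelfAdjoint_JD_iff`), i.e. `Sym²₀` of the
defining representation; "irreducible" is rendered, as in rows A1-166/168/171, by: every `K`-subspace `P ⊆ 𝔤_+` stable
under `X ↦ [A, X] = AX - XA` (`A ∈ 𝔬(2l)`) is `⊥` or `𝔤_+` (`eq_bot_or_eq_of_forall_comm_mem`).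

## Proof (Humphreys' weight calculus [Humphreys1972, §20.1–§20.2] made elementary; [Humphreys1972, §2 Exercise 6])

For `n ∈ 𝔬(2l)` with `n² = 0`, `(ad n)²X = -2·nXn`, so a stable `P` contains `n_{ab}Xn_{ab}` and `p_{ab}Xp_{ab}` with
`X` (§4).  For self-adjoint `X`, `n_{ab}Xn_{ab} = X_{b'a}(E_{ab'} + E_{ba'}) - X_{b'b}E_{aa'} - X_{a'a}E_{bb'}` — three
weight vectors of weights `ε_a + ε_b`, `2ε_a`, `2ε_b`, on which `h_a = E_{aa} - E_{a'a'}` has the values `1, 2, 0`; two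
brackets with `h_a` separate them (`smul_mem_of_comb_mem`), so a non-zero lower-left entry of `X` yields some
`E_{uu'} ∈ P` (§5; an upper-right entry is first moved down by `p_{ab}Xp_{ab}`, an upper-left one by `[n_{ab}, X]`).  If
no entry is usable, `X = c·1` is scalar and `tr X = 2|l|c = 0` gives `X = 0` — here `2|l| ≠ 0` in `K` is NEEDED (for
`char K ∣ 2|l|` the identity is traceless and `K·1 ⊆ 𝔤_+` is a stable line).  Conversely one `E_{uu'}` (a maximal
vector, weight `2ε_u`) generates everything (§6, `|l| ≥ 2`): the bracket table of §3 produces all `E_{vv'}`,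
`E_{ab'} + E_{ba'}`, `E_{ab} + E_{b'a'}` (`a ≠ b`), `E_{v'v}`, `E_{a'b} + E_{b'a}` and the zero-weight differences
`d_a - d_b` (`d_a = E_{aa} + E_{a'a'}`), and these span the traceless self-adjoint matrices (`mem_of_forall_units_mem`:
`Σ_a A_{aa} d_a = Σ_a A_{aa}(d_a - d_{a₀})` because `Σ_a A_{aa} = ½ tr X = 0`).

## Contents (all proved)

* §1 `isSelfAdjoint_JD_iff`, **`fromBlocks_isSelfAdjoint_JD_iff`** (`(A B; C D)` self-adjoint iff `D = Aᵀ`, `Bᵀ = B`,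
  `Cᵀ = C`), entries `apply_inr_inr` / `apply_inl_inr` / `apply_inr_inl`, `trace_eq_two_mul_sum` (`tr X = 2 Σ_a X_{aa}`);
* §2 the self-adjoint units `single_inl_inr_isSelfAdjoint` (`E_{aa'}`), `single_inr_inl_isSelfAdjoint`,
  `single_inl_inr_add_isSelfAdjoint` (`E_{ab'} + E_{ba'}`), `single_inr_inl_add_isSelfAdjoint`,
  `single_inl_inl_add_single_inr_inr_isSelfAdjoint` (`E_{ab} + E_{b'a'}`, `d_a`);
* §3 the bracket table `msub_comm_single_inl_inr` (`[m(E_{vu}), E_{uu'}] = E_{uv'} + E_{vu'}`), `h_comm_single_inl_inr`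
  (`= 2E_{aa'}`), `h_comm_single_inl_inr_of_ne` (`= 0`), `h_comm_single_inl_inr_add` (`[h_a, E_{ab'} + E_{ba'}] = E_{ab'} + E_{ba'}`),
  `msub_comm_single_inl_inr_add` (`= 2E_{vv'}`), `psub_comm_single_inl_inr` (`[p_{uv}, E_{uu'}] = -(E_{uv} + E_{v'u'})`),
  `psub_comm_single_inl_inl_add` (`= -2E_{v'v}`), `msub_comm_single_inr_inl` (`[m(E_{uv}), E_{u'u}] = -(E_{u'v} + E_{v'u})`),
  `psub_comm_single_inl_inr_add` (`[p_{uv}, E_{uv'} + E_{vu'}] = d_u - d_v`);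
* §4 `nsub_mul_mul_nsub_mem`, `psub_mul_mul_psub_mem`, **`smul_mem_of_comb_mem`**, `exists_single_inl_inr_mem_of_comb_mem`;
* §5 `exists_single_inl_inr_mem_of_lowerLeft` / `_of_upperRight` / `_of_upperLeft`;
* §6 **`mem_of_forall_units_mem`** (spanning; `B + Bᵀ = Σ B_{ab}(E_{ab} + E_{ba})` is p17's `SymplecticSimple.add_transpose_eq_sum_smul`), **`mem_of_single_inl_inr_mem`** (generation),
  **`eq_bot_or_forall_mem_of_forall_comm_mem`** (the core: `2 ≠ 0`, `|l| ≠ 0` in `K`, `|l| ≥ 2`);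
* §7 `mem_selfAdjoint_inf_ker_trace_iff`, **`eq_bot_or_eq_of_forall_comm_mem`** (`P = ⊥ ∨ P = sym_s ⊓ ker tr`),
  `eq_bot_or_eq_of_forall_comm_mem_of_charZero`, `single_inl_inr_mem_selfAdjoint_inf_ker_trace` (`𝔤_+ ≠ 0`).
* §8 (rider A1-175, basis-free) **`eq_bot_or_eq_of_core`** (transport of a matrix core for `𝔤_+` through `X ↦ [X]_b`,
  rows A1-166/171's bridges + `LinearMap.trace_eq_matrix_trace`), **`eq_bot_or_eq_of_forall_lie_mem_of_toMatrix_eq_JD`**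
  (a basis with Gram `JD m K`, `2 ≠ 0`, `|m| ≠ 0` in `K`, `|m| ≥ 2`: every `ad(𝔰𝔬(U,B))`-stable `K`-subspace of
  `B.selfAdjointSubmodule ⊓ ker (LinearMap.trace K U)` is `⊥` or everything), **`eq_bot_or_eq_of_forall_lie_mem_of_even`**
  (algebraically closed `K`, `dim U = 2m ≥ 4`, `B` non-degenerate symmetric; row A1-171's `exists_basis_toMatrix_eq_JD`),
  `…_of_even_of_charZero`, `exists_ne_zero_mem_selfAdjoint_inf_ker_trace` (non-vacuity).

## Scope

EVEN-dimensional orthogonal `U` only: the split form in coordinates (type `D_ℓ`, `ℓ = |l| ≥ 2`, i.e. `dim U = 2ℓ ≥ 4`;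
`dim U = 4` INCLUDED — the dimension-`4` exception of (7.5) concerns `𝔤_-`, rows A1-165/171) in §1–§7, and basis-free
(`B.selfAdjointSubmodule ⊓ ker (LinearMap.trace K U)` of `GlSelfAdjointDecomposition.lean`, for a basis with Gram `JD`
over any field, or any non-degenerate symmetric `B` over an algebraically closed field) in §8.  NOT here: the odd form
`(0 I; I 0) ⊕ (1)` (type `B_ℓ`, `dim U` odd), the symplectic `𝔤_+(U) ≅ Λ²₀U`, real non-split forms, and the reducible
plane `|l| = 1` (row A1-167, `SplitOrthogonalFourIdeals.lean` §6).  The characteristic hypothesis `|l| ≠ 0` in `K` is not in the source (which works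
over `ℂ`) and is necessary as stated above.  Nothing here is a case of the Hodge conjecture.

## References

* [LooijengaLunts1997] E. Looijenga, V. A. Lunts, *A Lie algebra attached to a projective variety*, Invent. Math. 129
  (1997) 361–412, Appendix Lemma (7.5), p. 28.
* [Humphreys1972] J. E. Humphreys, *Introduction to Lie Algebras and Representation Theory*, GTM 9, Springer 1972,
  §1.2 pp. 3–4 (type D_ℓ), §2 Exercise 6, §19.2, §20.1–§20.2.
-/

namespace Literature.Algebra.Lie.OrthogonalSelfAdjointTypeD

open LieAlgebra LieAlgebra.Orthogonal Matrix Sum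

variable {l : Type*} [Fintype l] [DecidableEq l] {R : Type*} [CommRing R] {K : Type*} [Field K]

/-! ### Matrix units (file-private plumbing) -/

/-- Matrix units: `E_{pq}E_{rs} = 0` for `q ≠ r`. [folklore] -/
private theorem E_mul_E_of_ne {ι : Type*} [Fintype ι] [DecidableEq ι] {p q r s : ι} (h : q ≠ r) :
    single p q (1 : R) * single r s (1 : R) = 0 :=
  single_mul_single_of_ne _ _ _ _ h _

/-- Matrix units: `E_{pq}E_{qs} = E_{ps}`. [folklore] -/
private theorem E_mul_E {ι : Type*} [Fintype ι] [DecidableEq ι] (p q s : ι) :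
    single p q (1 : R) * single q s (1 : R) = single p s 1 := by
  rw [single_mul_single_same, mul_one]

/-- Matrix units of size `2l`: `E_{p a'}E_{b s} = 0`. [folklore] -/
private theorem E_inr_mul_E_inl (p s : l ⊕ l) (a b : l) :
    single p (inr a) (1 : R) * single (inl b) s (1 : R) = 0 :=
  E_mul_E_of_ne inr_ne_inl

/-- Matrix units of size `2l`: `E_{p a}E_{b' s} = 0`. [folklore] -/
private theorem E_inl_mul_E_inr (p s : l ⊕ l) (a b : l) :
    single p (inl a) (1 : R) * single (inr b) s (1 : R) = 0 :=
  E_mul_E_of_ne inl_ne_inr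

/-- `cE_{pq} = c • E_{pq}`. [folklore] -/
private theorem single_eq_smul_E {ι : Type*} [DecidableEq ι] (p q : ι) (c : R) :
    single p q c = c • single p q (1 : R) := by
  rw [smul_single, smul_eq_mul, mul_one]

/-! ### §1 Self-adjoint matrices for `s = JD l R = (0 I; I 0)`: block form, entries, trace -/

/-- `X` is self-adjoint for `s = (0 I; I 0)` iff `Xᵀs = sX` (Mathlib's `Matrix.IsSelfAdjoint`, definitional).
[cite: LooijengaLunts1997, Appendix (7.5), p. 28 L80–L84 ("⟨xu, u'⟩ = +⟨u, xu'⟩")] -/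
theorem isSelfAdjoint_JD_iff (X : Matrix (l ⊕ l) (l ⊕ l) R) :
    (JD l R).IsSelfAdjoint X ↔ Xᵀ * JD l R = JD l R * X :=
  Iff.rfl

/-- **Block form of the `s`-self-adjoint matrices** (`s = (0 I; I 0)`): `(A B; C D)` is self-adjoint iff `D = Aᵀ`,
`Bᵀ = B`, `Cᵀ = C` — compare Humphreys' `q = -mᵗ`, `nᵗ = -n`, `pᵗ = -p` for the SKEW matrices `𝔬(2l)`.
[cite: Humphreys1972, §1.2, pp. 3–4 (type D_ℓ)] [cite: LooijengaLunts1997, Appendix (7.5), p. 28] -/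
theorem fromBlocks_isSelfAdjoint_JD_iff (A B C D : Matrix l l R) :
    (JD l R).IsSelfAdjoint (fromBlocks A B C D) ↔ D = Aᵀ ∧ Bᵀ = B ∧ Cᵀ = C := by
  rw [isSelfAdjoint_JD_iff, JD, fromBlocks_transpose, fromBlocks_multiply, fromBlocks_multiply, fromBlocks_inj]
  simp only [Matrix.mul_zero, Matrix.mul_one, zero_add, add_zero, Matrix.zero_mul, Matrix.one_mul]
  constructor
  · rintro ⟨hC, hA, -, hB⟩
    exact ⟨hA.symm, hB, hC⟩
  · rintro ⟨hD, hB, hC⟩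
    exact ⟨hC, hD.symm, by rw [hD, transpose_transpose], hB⟩

/-- Lower-right block of a self-adjoint `X`: `X_{a'b'} = X_{ba}`. [cite: Humphreys1972, §1.2, p. 4 (type D_ℓ)] -/
theorem apply_inr_inr {X : Matrix (l ⊕ l) (l ⊕ l) R} (hX : (JD l R).IsSelfAdjoint X) (a b : l) :
    X (inr a) (inr b) = X (inl b) (inl a) := by
  rw [← fromBlocks_toBlocks X, fromBlocks_isSelfAdjoint_JD_iff] at hX
  simpa [toBlocks₂₂, toBlocks₁₁] using congrFun (congrFun hX.1 a) b

/-- Upper-right block of a self-adjoint `X` is symmetric: `X_{ab'} = X_{ba'}`. [cite: Humphreys1972, §1.2, p. 4 (type D_ℓ)] -/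
theorem apply_inl_inr {X : Matrix (l ⊕ l) (l ⊕ l) R} (hX : (JD l R).IsSelfAdjoint X) (a b : l) :
    X (inl a) (inr b) = X (inl b) (inr a) := by
  rw [← fromBlocks_toBlocks X, fromBlocks_isSelfAdjoint_JD_iff] at hX
  simpa [toBlocks₁₂] using (congrFun (congrFun hX.2.1 a) b).symm

/-- Lower-left block of a self-adjoint `X` is symmetric: `X_{a'b} = X_{b'a}`. [cite: Humphreys1972, §1.2, p. 4 (type D_ℓ)] -/
theorem apply_inr_inl {X : Matrix (l ⊕ l) (l ⊕ l) R} (hX : (JD l R).IsSelfAdjoint X) (a b : l) :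
    X (inr a) (inl b) = X (inr b) (inl a) := by
  rw [← fromBlocks_toBlocks X, fromBlocks_isSelfAdjoint_JD_iff] at hX
  simpa [toBlocks₂₁] using (congrFun (congrFun hX.2.2 a) b).symm

/-- The trace of a self-adjoint `X = (A B; C Aᵀ)` is `2 tr A = 2 Σ_a X_{aa}`. [cite: LooijengaLunts1997, Appendix (7.5), p. 28 (𝔤_+(U) ⊂ 𝔰𝔩(U))] -/
theorem trace_eq_two_mul_sum {X : Matrix (l ⊕ l) (l ⊕ l) R} (hX : (JD l R).IsSelfAdjoint X) :
    Matrix.trace X = 2 * ∑ a, X (inl a) (inl a) := by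
  rw [Matrix.trace, Fintype.sum_sum_type, two_mul]
  simp only [diag_apply, apply_inr_inr hX]

/-! ### §2 Self-adjoint matrix units: `E_{aa'}`, `E_{a'a}`, `E_{ab'} + E_{ba'}`, `E_{a'b} + E_{b'a}`, `E_{ab} + E_{b'a'}` -/

/-- `E_{aa'}` (block `(0 E_{aa}; 0 0)`) is self-adjoint. [cite: Humphreys1972, §1.2, p. 4] [cite: LooijengaLunts1997, Appendix (7.5)] -/
theorem single_inl_inr_isSelfAdjoint (a : l) : (JD l R).IsSelfAdjoint (single (inl a) (inr a) (1 : R)) := by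
  rw [SymplecticSimple.single_inl_inr, fromBlocks_isSelfAdjoint_JD_iff]
  exact ⟨by simp, transpose_single a a 1, by simp⟩

/-- `E_{a'a}` (block `(0 0; E_{aa} 0)`) is self-adjoint. [cite: Humphreys1972, §1.2, p. 4] [cite: LooijengaLunts1997, Appendix (7.5)] -/
theorem single_inr_inl_isSelfAdjoint (a : l) : (JD l R).IsSelfAdjoint (single (inr a) (inl a) (1 : R)) := by
  rw [SymplecticSimple.single_inr_inl, fromBlocks_isSelfAdjoint_JD_iff]
  exact ⟨by simp, by simp, transpose_single a a 1⟩

/-- `E_{ab'} + E_{ba'}` (block `(0 E_{ab}+E_{ba}; 0 0)`) is self-adjoint. [cite: Humphreys1972, §1.2, p. 4] [cite: LooijengaLunts1997, Appendix (7.5)] -/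
theorem single_inl_inr_add_isSelfAdjoint (a b : l) :
    (JD l R).IsSelfAdjoint (single (inl a) (inr b) (1 : R) + single (inl b) (inr a) 1) := by
  rw [SymplecticSimple.single_inl_inr, SymplecticSimple.single_inl_inr, fromBlocks_add, fromBlocks_isSelfAdjoint_JD_iff]
  refine ⟨by simp, ?_, by simp⟩
  rw [transpose_add, transpose_single, transpose_single, add_comm]

/-- `E_{a'b} + E_{b'a}` (block `(0 0; E_{ab}+E_{ba} 0)`) is self-adjoint. [cite: Humphreys1972, §1.2, p. 4] [cite: LooijengaLunts1997, Appendix (7.5)] -/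
theorem single_inr_inl_add_isSelfAdjoint (a b : l) :
    (JD l R).IsSelfAdjoint (single (inr a) (inl b) (1 : R) + single (inr b) (inl a) 1) := by
  rw [SymplecticSimple.single_inr_inl, SymplecticSimple.single_inr_inl, fromBlocks_add, fromBlocks_isSelfAdjoint_JD_iff]
  refine ⟨by simp, by simp, ?_⟩
  rw [transpose_add, transpose_single, transpose_single, add_comm]

/-- `E_{ab} + E_{b'a'}` (block `(E_{ab} 0; 0 E_{ba})`; for `a = b` the diagonal `d_a = E_{aa} + E_{a'a'}`) is self-adjoint.
[cite: Humphreys1972, §1.2, p. 4] [cite: LooijengaLunts1997, Appendix (7.5)] -/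
theorem single_inl_inl_add_single_inr_inr_isSelfAdjoint (a b : l) :
    (JD l R).IsSelfAdjoint (single (inl a) (inl b) (1 : R) + single (inr b) (inr a) 1) := by
  rw [SymplecticSimple.single_inl_inl, SymplecticSimple.single_inr_inr, fromBlocks_add, fromBlocks_isSelfAdjoint_JD_iff]
  refine ⟨?_, by simp, by simp⟩
  rw [zero_add, add_zero, transpose_single]

/-! ### §3 Bracket table: Humphreys' basis of `𝔬(2l)` acting on the self-adjoint units [Humphreys1972, §1.2, §20.1]

`m(E_{vu}) = E_{vu} - E_{u'v'}` (`h_u = m(E_{uu})`), `n_{uv} = E_{uv'} - E_{vu'}`, `p_{uv} = E_{u'v} - E_{v'u}` are Humphreys'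
basis vectors of `𝔬(2l)`; the identities are the weight-vector calculus of `Sym²` of the defining representation in
coordinates. -/

/-- `[m(E_{vu}), E_{uu'}] = E_{uv'} + E_{vu'}` (for `u = v`: `[h_u, E_{uu'}] = 2E_{uu'}`). [cite: Humphreys1972, §1.2, p. 4] -/
theorem msub_comm_single_inl_inr (u v : l) :
    (single (inl v) (inl u) (1 : R) - single (inr u) (inr v) 1) * single (inl u) (inr u) (1 : R)
      - single (inl u) (inr u) (1 : R) * (single (inl v) (inl u) (1 : R) - single (inr u) (inr v) 1)
      = single (inl u) (inr v) 1 + single (inl v) (inr u) 1 := by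
  rw [Matrix.sub_mul, Matrix.mul_sub, E_mul_E, E_inr_mul_E_inl, E_inr_mul_E_inl, E_mul_E]
  abel

/-- `[h_a, E_{aa'}] = 2E_{aa'}`. [cite: Humphreys1972, §1.2, p. 4] -/
theorem h_comm_single_inl_inr (a : l) :
    (single (inl a) (inl a) (1 : R) - single (inr a) (inr a) 1) * single (inl a) (inr a) (1 : R)
      - single (inl a) (inr a) (1 : R) * (single (inl a) (inl a) (1 : R) - single (inr a) (inr a) 1)
      = (2 : R) • single (inl a) (inr a) 1 := by
  rw [msub_comm_single_inl_inr, two_smul]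

/-- `[h_a, E_{bb'}] = 0` for `a ≠ b`. [cite: Humphreys1972, §1.2, p. 4] -/
theorem h_comm_single_inl_inr_of_ne {a b : l} (hab : a ≠ b) :
    (single (inl a) (inl a) (1 : R) - single (inr a) (inr a) 1) * single (inl b) (inr b) (1 : R)
      - single (inl b) (inr b) (1 : R) * (single (inl a) (inl a) (1 : R) - single (inr a) (inr a) 1) = 0 := by
  have h1 : (inl a : l ⊕ l) ≠ inl b := fun h => hab (inl_injective h)
  have h2 : (inr b : l ⊕ l) ≠ inr a := fun h => hab (inr_injective h).symm
  simp only [Matrix.sub_mul, Matrix.mul_sub, E_mul_E_of_ne h1, E_inr_mul_E_inl, E_mul_E_of_ne h2, sub_zero]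

/-- `[h_a, E_{ab'} + E_{ba'}] = E_{ab'} + E_{ba'}` for `a ≠ b`. [cite: Humphreys1972, §1.2, p. 4] -/
theorem h_comm_single_inl_inr_add {a b : l} (hab : a ≠ b) :
    (single (inl a) (inl a) (1 : R) - single (inr a) (inr a) 1) * (single (inl a) (inr b) (1 : R) + single (inl b) (inr a) 1)
      - (single (inl a) (inr b) (1 : R) + single (inl b) (inr a) 1) * (single (inl a) (inl a) (1 : R) - single (inr a) (inr a) 1)
      = single (inl a) (inr b) 1 + single (inl b) (inr a) 1 := by
  have h1 : (inl a : l ⊕ l) ≠ inl b := fun h => hab (inl_injective h)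
  have h2 : (inr b : l ⊕ l) ≠ inr a := fun h => hab (inr_injective h).symm
  simp only [Matrix.sub_mul, Matrix.mul_add, Matrix.add_mul, Matrix.mul_sub, E_mul_E, E_mul_E_of_ne h1, E_inr_mul_E_inl,
    E_mul_E_of_ne h2]
  abel

/-- `[m(E_{vu}), E_{uv'} + E_{vu'}] = 2E_{vv'}` for `u ≠ v`. [cite: Humphreys1972, §1.2, p. 4] -/
theorem msub_comm_single_inl_inr_add {u v : l} (huv : u ≠ v) :
    (single (inl v) (inl u) (1 : R) - single (inr u) (inr v) 1) * (single (inl u) (inr v) (1 : R) + single (inl v) (inr u) 1)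
      - (single (inl u) (inr v) (1 : R) + single (inl v) (inr u) 1) * (single (inl v) (inl u) (1 : R) - single (inr u) (inr v) 1)
      = (2 : R) • single (inl v) (inr v) 1 := by
  have h1 : (inl u : l ⊕ l) ≠ inl v := fun h => huv (inl_injective h)
  have h2 : (inr v : l ⊕ l) ≠ inr u := fun h => huv (inr_injective h).symm
  simp only [Matrix.sub_mul, Matrix.mul_add, Matrix.add_mul, Matrix.mul_sub, E_mul_E, E_mul_E_of_ne h1, E_inr_mul_E_inl,
    E_mul_E_of_ne h2]
  rw [two_smul]
  abel

/-- `[p_{uv}, E_{uu'}] = -(E_{uv} + E_{v'u'})` for `u ≠ v`. [cite: Humphreys1972, §1.2, p. 4] -/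
theorem psub_comm_single_inl_inr {u v : l} (huv : u ≠ v) :
    (single (inr u) (inl v) (1 : R) - single (inr v) (inl u) 1) * single (inl u) (inr u) (1 : R)
      - single (inl u) (inr u) (1 : R) * (single (inr u) (inl v) (1 : R) - single (inr v) (inl u) 1)
      = -(single (inl u) (inl v) 1 + single (inr v) (inr u) 1) := by
  have h1 : (inl v : l ⊕ l) ≠ inl u := fun h => huv (inl_injective h).symm
  have h2 : (inr u : l ⊕ l) ≠ inr v := fun h => huv (inr_injective h)
  rw [Matrix.sub_mul, Matrix.mul_sub, E_mul_E_of_ne h1, E_mul_E, E_mul_E, E_mul_E_of_ne h2]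
  abel

/-- `[p_{uv}, E_{uv} + E_{v'u'}] = -2E_{v'v}` for `u ≠ v`. [cite: Humphreys1972, §1.2, p. 4] -/
theorem psub_comm_single_inl_inl_add {u v : l} (huv : u ≠ v) :
    (single (inr u) (inl v) (1 : R) - single (inr v) (inl u) 1) * (single (inl u) (inl v) (1 : R) + single (inr v) (inr u) 1)
      - (single (inl u) (inl v) (1 : R) + single (inr v) (inr u) 1) * (single (inr u) (inl v) (1 : R) - single (inr v) (inl u) 1)
      = -((2 : R) • single (inr v) (inl v) 1) := by
  have h1 : (inl v : l ⊕ l) ≠ inl u := fun h => huv (inl_injective h).symm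
  have h2 : (inr u : l ⊕ l) ≠ inr v := fun h => huv (inr_injective h)
  simp only [Matrix.sub_mul, Matrix.mul_add, Matrix.add_mul, Matrix.mul_sub, E_mul_E, E_mul_E_of_ne h1, E_inl_mul_E_inr,
    E_mul_E_of_ne h2]
  rw [two_smul]
  abel

/-- `[m(E_{uv}), E_{u'u}] = -(E_{u'v} + E_{v'u})` (for `u = v`: `[h_u, E_{u'u}] = -2E_{u'u}`). [cite: Humphreys1972, §1.2, p. 4] -/
theorem msub_comm_single_inr_inl (u v : l) :
    (single (inl u) (inl v) (1 : R) - single (inr v) (inr u) 1) * single (inr u) (inl u) (1 : R)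
      - single (inr u) (inl u) (1 : R) * (single (inl u) (inl v) (1 : R) - single (inr v) (inr u) 1)
      = -(single (inr u) (inl v) 1 + single (inr v) (inl u) 1) := by
  rw [Matrix.sub_mul, Matrix.mul_sub, E_inl_mul_E_inr, E_mul_E, E_mul_E, E_inl_mul_E_inr]
  abel

/-- `[p_{uv}, E_{uv'} + E_{vu'}] = (E_{uu} + E_{u'u'}) - (E_{vv} + E_{v'v'})` for `u ≠ v` (a zero-weight vector).
[cite: Humphreys1972, §1.2, p. 4] -/
theorem psub_comm_single_inl_inr_add {u v : l} (huv : u ≠ v) :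
    (single (inr u) (inl v) (1 : R) - single (inr v) (inl u) 1) * (single (inl u) (inr v) (1 : R) + single (inl v) (inr u) 1)
      - (single (inl u) (inr v) (1 : R) + single (inl v) (inr u) 1) * (single (inr u) (inl v) (1 : R) - single (inr v) (inl u) 1)
      = (single (inl u) (inl u) 1 + single (inr u) (inr u) 1) - (single (inl v) (inl v) 1 + single (inr v) (inr v) 1) := by
  have h1 : (inl v : l ⊕ l) ≠ inl u := fun h => huv (inl_injective h).symm
  have h1' : (inl u : l ⊕ l) ≠ inl v := fun h => huv (inl_injective h)
  have h2 : (inr v : l ⊕ l) ≠ inr u := fun h => huv (inr_injective h).symm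
  have h2' : (inr u : l ⊕ l) ≠ inr v := fun h => huv (inr_injective h)
  simp only [Matrix.sub_mul, Matrix.mul_add, Matrix.add_mul, Matrix.mul_sub, E_mul_E, E_mul_E_of_ne h1,
    E_mul_E_of_ne h1', E_mul_E_of_ne h2, E_mul_E_of_ne h2']
  abel

/-! ### §4 An `ad 𝔬(2l)`-stable subspace of self-adjoint matrices: sandwiches and separation of components

For `n² = 0` one has `(ad n)²X = -2·nXn` (`OrthogonalSimpleTypeD.comm_comm_eq_of_mul_self_eq_zero`), so a subspace `P`
stable under `ad 𝔬(2l)` contains `nXn` and `pXp` with every `X ∈ P` (`2 ≠ 0`); the Cartan element `h_a` then separates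
the three weight components of `n_{ab}Xn_{ab}`. -/

section stable

variable {P : Submodule K (Matrix (l ⊕ l) (l ⊕ l) K)}

/-- `n_{ab} X n_{ab} ∈ P` for `X ∈ P`, `P` stable under `ad 𝔬(2l)`, `2 ≠ 0`. [cite: Humphreys1972, §2 Exercise 6, §19.2] -/
theorem nsub_mul_mul_nsub_mem (h2 : (2 : K) ≠ 0)
    (hP : ∀ ⦃Y m : Matrix (l ⊕ l) (l ⊕ l) K⦄, Y ∈ typeD l K → m ∈ P → Y * m - m * Y ∈ P)
    {X : Matrix (l ⊕ l) (l ⊕ l) K} (hXP : X ∈ P) (a b : l) :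
    (single (inl a) (inr b) (1 : K) - single (inl b) (inr a) 1) * X * (single (inl a) (inr b) (1 : K) - single (inl b) (inr a) 1)
      ∈ P := by
  have hn := OrthogonalSimpleTypeD.single_inl_inr_sub_mem_typeD (R := K) a b
  have h1 := hP hn (hP hn hXP)
  rw [OrthogonalSimpleTypeD.comm_comm_eq_of_mul_self_eq_zero (OrthogonalSimpleTypeD.nsub_mul_self a b), P.neg_mem_iff,
    P.smul_mem_iff h2] at h1
  exact h1

/-- `p_{ab} X p_{ab} ∈ P` for `X ∈ P`, `P` stable under `ad 𝔬(2l)`, `2 ≠ 0`. [cite: Humphreys1972, §2 Exercise 6, §19.2] -/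
theorem psub_mul_mul_psub_mem (h2 : (2 : K) ≠ 0)
    (hP : ∀ ⦃Y m : Matrix (l ⊕ l) (l ⊕ l) K⦄, Y ∈ typeD l K → m ∈ P → Y * m - m * Y ∈ P)
    {X : Matrix (l ⊕ l) (l ⊕ l) K} (hXP : X ∈ P) (a b : l) :
    (single (inr a) (inl b) (1 : K) - single (inr b) (inl a) 1) * X * (single (inr a) (inl b) (1 : K) - single (inr b) (inl a) 1)
      ∈ P := by
  have hp := OrthogonalSimpleTypeD.single_inr_inl_sub_mem_typeD (R := K) a b
  have h1 := hP hp (hP hp hXP)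
  rw [OrthogonalSimpleTypeD.comm_comm_eq_of_mul_self_eq_zero (OrthogonalSimpleTypeD.psub_mul_self a b), P.neg_mem_iff,
    P.smul_mem_iff h2] at h1
  exact h1

/-- **Separation by `h_a`**: if `α(E_{ab'} + E_{ba'}) - βE_{aa'} - γE_{bb'} ∈ P` (`a ≠ b`; weights `ε_a + ε_b`, `2ε_a`,
`2ε_b` take the values `1, 2, 0` on `h_a`), then each of the three components lies in `P`: with `Z₁ = [h_a, Z]`,
`Z₂ = [h_a, Z₁]` one has `Z₁ - Z₂ = 2βE_{aa'}`, `Z₁ + 2βE_{aa'} = α(E_{ab'} + E_{ba'})`. [cite: Humphreys1972, §20.1 Lemma (a) (root vectors shift weight spaces; H separates them), §1.2] -/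
theorem smul_mem_of_comb_mem (h2 : (2 : K) ≠ 0)
    (hP : ∀ ⦃Y m : Matrix (l ⊕ l) (l ⊕ l) K⦄, Y ∈ typeD l K → m ∈ P → Y * m - m * Y ∈ P) {a b : l} (hab : a ≠ b)
    {α β γ : K}
    (hZ : α • ((single (inl a) (inr b) (1 : K) : Matrix (l ⊕ l) (l ⊕ l) K) + single (inl b) (inr a) 1)
      - β • single (inl a) (inr a) (1 : K) - γ • single (inl b) (inr b) (1 : K) ∈ P) :
    α • ((single (inl a) (inr b) (1 : K) : Matrix (l ⊕ l) (l ⊕ l) K) + single (inl b) (inr a) 1) ∈ P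
      ∧ β • (single (inl a) (inr a) (1 : K) : Matrix (l ⊕ l) (l ⊕ l) K) ∈ P
      ∧ γ • (single (inl b) (inr b) (1 : K) : Matrix (l ⊕ l) (l ⊕ l) K) ∈ P := by
  set B : Matrix (l ⊕ l) (l ⊕ l) K := single (inl a) (inr b) (1 : K) + single (inl b) (inr a) 1 with hB
  set Ea : Matrix (l ⊕ l) (l ⊕ l) K := single (inl a) (inr a) (1 : K) with hEa
  set Eb : Matrix (l ⊕ l) (l ⊕ l) K := single (inl b) (inr b) (1 : K) with hEb
  set h : Matrix (l ⊕ l) (l ⊕ l) K := single (inl a) (inl a) (1 : K) - single (inr a) (inr a) 1 with hh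
  have hhD : h ∈ typeD l K := OrthogonalSimpleTypeD.single_inl_inl_sub_single_inr_inr_mem_typeD a a
  have hB' : h * B - B * h = B := by rw [hh, hB]; exact h_comm_single_inl_inr_add hab
  have hEa' : h * Ea - Ea * h = (2 : K) • Ea := by rw [hh, hEa]; exact h_comm_single_inl_inr a
  have hEb' : h * Eb - Eb * h = 0 := by rw [hh, hEb]; exact h_comm_single_inl_inr_of_ne hab
  have had : ∀ x y : K, h * (x • B - y • Ea) - (x • B - y • Ea) * h = x • B - (2 * y) • Ea := by
    intro x y
    have e : h * (x • B - y • Ea) - (x • B - y • Ea) * h = x • (h * B - B * h) - y • (h * Ea - Ea * h) := by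
      simp only [Matrix.mul_sub, Matrix.sub_mul, Matrix.mul_smul, Matrix.smul_mul, smul_sub]
      abel
    rw [e, hB', hEa', smul_smul, mul_comm y 2]
  -- `Z₁ = [h_a, Z]`
  have e1 : h * (α • B - β • Ea - γ • Eb) - (α • B - β • Ea - γ • Eb) * h = α • B - (2 * β) • Ea := by
    have e : h * (α • B - β • Ea - γ • Eb) - (α • B - β • Ea - γ • Eb) * h
        = (h * (α • B - β • Ea) - (α • B - β • Ea) * h) - γ • (h * Eb - Eb * h) := by
      simp only [Matrix.mul_sub, Matrix.sub_mul, Matrix.mul_smul, Matrix.smul_mul, smul_sub]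
      abel
    rw [e, had, hEb', smul_zero, sub_zero]
  have hZ1 := hP hhD hZ
  rw [e1] at hZ1
  -- `Z₂ = [h_a, Z₁]`
  have hZ2 := hP hhD hZ1
  rw [had] at hZ2
  have h2β : (2 * β) • Ea ∈ P := by
    have e : α • B - (2 * β) • Ea - (α • B - (2 * (2 * β)) • Ea) = (2 * β) • Ea := by
      rw [sub_sub_sub_cancel_left, ← sub_smul]
      congr 1
      ring
    simpa only [e] using P.sub_mem hZ1 hZ2
  have hαB : α • B ∈ P := by simpa only [sub_add_cancel] using P.add_mem hZ1 h2β
  have hβ : β • Ea ∈ P := by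
    rw [mul_smul] at h2β
    exact (P.smul_mem_iff h2).1 h2β
  refine ⟨hαB, hβ, ?_⟩
  simpa only [sub_sub_cancel] using P.sub_mem (P.sub_mem hαB hβ) hZ

/-- From `α(E_{ab'} + E_{ba'}) - βE_{aa'} - γE_{bb'} ∈ P` with `(α, β, γ) ≠ 0` (`a ≠ b`): SOME `E_{uu'}` lies in `P`
(`[m(E_{ba}), E_{ab'} + E_{ba'}] = 2E_{bb'}` when only `α ≠ 0`). [cite: Humphreys1972, §1.2, §20.1] -/
theorem exists_single_inl_inr_mem_of_comb_mem (h2 : (2 : K) ≠ 0)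
    (hP : ∀ ⦃Y m : Matrix (l ⊕ l) (l ⊕ l) K⦄, Y ∈ typeD l K → m ∈ P → Y * m - m * Y ∈ P) {a b : l} (hab : a ≠ b)
    {α β γ : K} (hne : α ≠ 0 ∨ β ≠ 0 ∨ γ ≠ 0)
    (hZ : α • ((single (inl a) (inr b) (1 : K) : Matrix (l ⊕ l) (l ⊕ l) K) + single (inl b) (inr a) 1)
      - β • single (inl a) (inr a) (1 : K) - γ • single (inl b) (inr b) (1 : K) ∈ P) :
    ∃ u : l, single (inl u) (inr u) (1 : K) ∈ P := by
  obtain ⟨hα, hβ, hγ⟩ := smul_mem_of_comb_mem h2 hP hab hZ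
  rcases hne with hne | hne | hne
  · have hBP := (P.smul_mem_iff hne).1 hα
    have h := hP (OrthogonalSimpleTypeD.single_inl_inl_sub_single_inr_inr_mem_typeD (R := K) b a) hBP
    rw [msub_comm_single_inl_inr_add hab, P.smul_mem_iff h2] at h
    exact ⟨b, h⟩
  · exact ⟨a, (P.smul_mem_iff hne).1 hβ⟩
  · exact ⟨b, (P.smul_mem_iff hne).1 hγ⟩

/-! ### §5 Extraction: a non-zero traceless self-adjoint member of `P` yields some `E_{uu'} ∈ P` -/

/-- Lower-left block: if `X ∈ P` is self-adjoint and one of `X_{b'a}, X_{b'b}, X_{a'a}` (`a ≠ b`) is non-zero, then some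
`E_{uu'} ∈ P` — via `n_{ab}Xn_{ab} = X_{b'a}(E_{ab'} + E_{ba'}) - X_{b'b}E_{aa'} - X_{a'a}E_{bb'}`.
[cite: Humphreys1972, §2 Exercise 6, §19.2] -/
theorem exists_single_inl_inr_mem_of_lowerLeft (h2 : (2 : K) ≠ 0)
    (hP : ∀ ⦃Y m : Matrix (l ⊕ l) (l ⊕ l) K⦄, Y ∈ typeD l K → m ∈ P → Y * m - m * Y ∈ P)
    {X : Matrix (l ⊕ l) (l ⊕ l) K} (hX : (JD l K).IsSelfAdjoint X) (hXP : X ∈ P) {a b : l} (hab : a ≠ b)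
    (hne : X (inr b) (inl a) ≠ 0 ∨ X (inr b) (inl b) ≠ 0 ∨ X (inr a) (inl a) ≠ 0) :
    ∃ u : l, single (inl u) (inr u) (1 : K) ∈ P := by
  have h := nsub_mul_mul_nsub_mem h2 hP hXP a b
  rw [OrthogonalSimpleTypeD.nsub_mul_mul_nsub, apply_inr_inl hX a b] at h
  refine exists_single_inl_inr_mem_of_comb_mem h2 hP hab hne ?_
  have e : X (inr b) (inl a) • ((single (inl a) (inr b) (1 : K) : Matrix (l ⊕ l) (l ⊕ l) K) + single (inl b) (inr a) 1)
      - X (inr b) (inl b) • single (inl a) (inr a) (1 : K) - X (inr a) (inl a) • single (inl b) (inr b) (1 : K)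
      = single (inl a) (inr b) (X (inr b) (inl a)) - single (inl a) (inr a) (X (inr b) (inl b))
        - single (inl b) (inr b) (X (inr a) (inl a)) + single (inl b) (inr a) (X (inr b) (inl a)) := by
    rw [single_eq_smul_E (inl a) (inr b) (X (inr b) (inl a)), single_eq_smul_E (inl a) (inr a) (X (inr b) (inl b)),
      single_eq_smul_E (inl b) (inr b) (X (inr a) (inl a)), single_eq_smul_E (inl b) (inr a) (X (inr b) (inl a)), smul_add]
    abel
  rwa [e]

/-- Upper-right block: if `X ∈ P` is self-adjoint and one of `X_{ab'}, X_{aa'}, X_{bb'}` (`a ≠ b`) is non-zero, then some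
`E_{uu'} ∈ P` — `p_{ab}Xp_{ab} ∈ P` has lower-left entries `X_{ab'}`, `-X_{aa'}`, `-X_{bb'}` at `(b', a)`, `(b', b)`, `(a', a)`.
[cite: Humphreys1972, §2 Exercise 6, §19.2] -/
theorem exists_single_inl_inr_mem_of_upperRight (h2 : (2 : K) ≠ 0)
    (hP : ∀ ⦃Y m : Matrix (l ⊕ l) (l ⊕ l) K⦄, Y ∈ typeD l K → m ∈ P → Y * m - m * Y ∈ P)
    (hPS : ∀ ⦃m : Matrix (l ⊕ l) (l ⊕ l) K⦄, m ∈ P → (JD l K).IsSelfAdjoint m)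
    {X : Matrix (l ⊕ l) (l ⊕ l) K} (hXP : X ∈ P) {a b : l} (hab : a ≠ b)
    (hne : X (inl a) (inr b) ≠ 0 ∨ X (inl a) (inr a) ≠ 0 ∨ X (inl b) (inr b) ≠ 0) :
    ∃ u : l, single (inl u) (inr u) (1 : K) ∈ P := by
  have hZ := psub_mul_mul_psub_mem h2 hP hXP a b
  rw [OrthogonalSimpleTypeD.psub_mul_mul_psub] at hZ
  refine exists_single_inl_inr_mem_of_lowerLeft h2 hP (hPS hZ) hZ hab ?_
  have hab1 : (inr a : l ⊕ l) ≠ inr b := fun h => hab (inr_injective h)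
  have hab2 : (inl a : l ⊕ l) ≠ inl b := fun h => hab (inl_injective h)
  simp only [Matrix.add_apply, Matrix.sub_apply, single_apply_same, single_apply_of_row_ne hab1,
    single_apply_of_row_ne hab1.symm, single_apply_of_col_ne _ _ hab2, single_apply_of_col_ne _ _ hab2.symm, zero_sub,
    sub_zero, zero_add, add_zero, neg_ne_zero]
  rcases hne with h | h | h
  · exact Or.inl h
  · exact Or.inr (Or.inl h)
  · exact Or.inr (Or.inr h)

/-- Upper-left block: if `X ∈ P` is self-adjoint and `X_{ab} ≠ 0`, `X_{ba} ≠ 0` or `X_{aa} ≠ X_{bb}` (`a ≠ b`), then some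
`E_{uu'} ∈ P` — `[n_{ab}, X] ∈ P` has upper-right entries `X_{bb} - X_{aa}`, `2X_{ab}`, `-2X_{ba}` at `(a, b')`, `(a, a')`,
`(b, b')`. [cite: Humphreys1972, §2 Exercise 6, §19.2] -/
theorem exists_single_inl_inr_mem_of_upperLeft (h2 : (2 : K) ≠ 0)
    (hP : ∀ ⦃Y m : Matrix (l ⊕ l) (l ⊕ l) K⦄, Y ∈ typeD l K → m ∈ P → Y * m - m * Y ∈ P)
    (hPS : ∀ ⦃m : Matrix (l ⊕ l) (l ⊕ l) K⦄, m ∈ P → (JD l K).IsSelfAdjoint m)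
    {X : Matrix (l ⊕ l) (l ⊕ l) K} (hXP : X ∈ P) {a b : l} (hab : a ≠ b)
    (hne : X (inl a) (inl b) ≠ 0 ∨ X (inl b) (inl a) ≠ 0 ∨ X (inl a) (inl a) ≠ X (inl b) (inl b)) :
    ∃ u : l, single (inl u) (inr u) (1 : K) ∈ P := by
  have hX := hPS hXP
  have hW := hP (OrthogonalSimpleTypeD.single_inl_inr_sub_mem_typeD (R := K) a b) hXP
  refine exists_single_inl_inr_mem_of_upperRight h2 hP hPS hW hab ?_
  have hab1 : (inl b : l ⊕ l) ≠ inl a := fun h => hab (inl_injective h).symm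
  have hab2 : (inr a : l ⊕ l) ≠ inr b := fun h => hab (inr_injective h)
  have eab : (((single (inl a) (inr b) (1 : K) - single (inl b) (inr a) 1) * X
      - X * (single (inl a) (inr b) (1 : K) - single (inl b) (inr a) 1) : Matrix (l ⊕ l) (l ⊕ l) K)) (inl a) (inr b) = X (inl b) (inl b) - X (inl a) (inl a) := by
    rw [Matrix.sub_apply, Matrix.sub_mul, Matrix.mul_sub, Matrix.sub_apply, Matrix.sub_apply, single_mul_apply_same,
      single_mul_apply_of_ne (h := hab1.symm), mul_single_apply_same, mul_single_apply_of_ne (hbj := hab2.symm), one_mul,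
      mul_one, sub_zero, sub_zero, apply_inr_inr hX]
  have eaa : (((single (inl a) (inr b) (1 : K) - single (inl b) (inr a) 1) * X
      - X * (single (inl a) (inr b) (1 : K) - single (inl b) (inr a) 1) : Matrix (l ⊕ l) (l ⊕ l) K)) (inl a) (inr a) = 2 * X (inl a) (inl b) := by
    rw [Matrix.sub_apply, Matrix.sub_mul, Matrix.mul_sub, Matrix.sub_apply, Matrix.sub_apply, single_mul_apply_same,
      single_mul_apply_of_ne (h := hab1.symm), mul_single_apply_of_ne (hbj := hab2), mul_single_apply_same, one_mul,
      mul_one, sub_zero, zero_sub, sub_neg_eq_add, apply_inr_inr hX, two_mul]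
  have ebb : (((single (inl a) (inr b) (1 : K) - single (inl b) (inr a) 1) * X
      - X * (single (inl a) (inr b) (1 : K) - single (inl b) (inr a) 1) : Matrix (l ⊕ l) (l ⊕ l) K)) (inl b) (inr b) = -(2 * X (inl b) (inl a)) := by
    rw [Matrix.sub_apply, Matrix.sub_mul, Matrix.mul_sub, Matrix.sub_apply, Matrix.sub_apply,
      single_mul_apply_of_ne (h := hab1), single_mul_apply_same, mul_single_apply_same, mul_single_apply_of_ne (hbj := hab2.symm),
      one_mul, mul_one, zero_sub, sub_zero, apply_inr_inr hX, two_mul, neg_add, sub_eq_add_neg]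
  rw [eab, eaa, ebb, sub_ne_zero, mul_ne_zero_iff, neg_ne_zero, mul_ne_zero_iff]
  rcases hne with h | h | h
  · exact Or.inr (Or.inl ⟨h2, h⟩)
  · exact Or.inr (Or.inr ⟨h2, h⟩)
  · exact Or.inl (Ne.symm h)

end stable

/-! ### §6 Generation: from one `E_{uu'}` to all of `Sym²₀` (`|l| ≥ 2`), and the spanning of the traceless self-adjoint matrices -/

section span

variable {P : Submodule K (Matrix (l ⊕ l) (l ⊕ l) K)}

/-- **Spanning**: ANY `K`-subspace `P` (`2 ≠ 0`) containing the self-adjoint units `E_{ab} + E_{b'a'}` (`a ≠ b`),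
`(E_{aa} + E_{a'a'}) - (E_{bb} + E_{b'b'})`, `E_{ab'} + E_{ba'}` and `E_{a'b} + E_{b'a}` contains every TRACELESS
self-adjoint matrix `X = (A B; C Aᵀ)`: `(A 0; 0 Aᵀ) = Σ_{a≠b} A_{ab}(E_{ab} + E_{b'a'}) + Σ_a A_{aa}(d_a - d_{a₀})`
(`Σ_a A_{aa} = ½ tr X = 0`), `2(0 B; 0 0) = Σ B_{ab}(E_{ab'} + E_{ba'})`, `2(0 0; C 0) = Σ C_{ab}(E_{a'b} + E_{b'a})`.
[cite: Humphreys1972, §1.2, pp. 3–4] [cite: LooijengaLunts1997, Appendix (7.5), p. 28] -/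
theorem mem_of_forall_units_mem (h2 : (2 : K) ≠ 0)
    (hQ : ∀ a b : l, a ≠ b → single (inl a) (inl b) (1 : K) + single (inr b) (inr a) 1 ∈ P)
    (hD : ∀ a b : l, (single (inl a) (inl a) (1 : K) + single (inr a) (inr a) 1)
      - (single (inl b) (inl b) (1 : K) + single (inr b) (inr b) 1) ∈ P)
    (hB : ∀ a b : l, single (inl a) (inr b) (1 : K) + single (inl b) (inr a) 1 ∈ P)
    (hC : ∀ a b : l, single (inr a) (inl b) (1 : K) + single (inr b) (inl a) 1 ∈ P)
    {X : Matrix (l ⊕ l) (l ⊕ l) K} (hX : (JD l K).IsSelfAdjoint X) (htr : Matrix.trace X = 0) : X ∈ P := by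
  have hPsmul : ∀ {c : K} {m : Matrix (l ⊕ l) (l ⊕ l) K}, c ≠ 0 → c • m ∈ P → m ∈ P :=
    fun hc hm => (P.smul_mem_iff hc).1 hm
  -- `Σ_a X_{aa} = 0`
  have htrA : ∑ a, X (inl a) (inl a) = 0 := by
    rw [trace_eq_two_mul_sum hX] at htr
    exact (mul_eq_zero.1 htr).resolve_left h2
  -- write `X = (A B; C Aᵀ)` with `B`, `C` symmetric
  rw [← fromBlocks_toBlocks X] at hX ⊢
  obtain ⟨hDA, hBB, hCC⟩ := (fromBlocks_isSelfAdjoint_JD_iff _ _ _ _).1 hX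
  rw [hDA]
  have e : fromBlocks X.toBlocks₁₁ X.toBlocks₁₂ X.toBlocks₂₁ X.toBlocks₁₁ᵀ =
      fromBlocks X.toBlocks₁₁ 0 0 X.toBlocks₁₁ᵀ + fromBlocks 0 X.toBlocks₁₂ 0 0 + fromBlocks 0 0 X.toBlocks₂₁ 0 := by
    rw [fromBlocks_add, fromBlocks_add]
    simp
  rw [e]
  refine add_mem (add_mem ?_ ?_) ?_
  · -- the diagonal blocks: `(A 0; 0 Aᵀ) = Σ A_{ab} (E_{ab} + E_{b'a'})`
    let L : Matrix l l K →ₗ[K] Matrix (l ⊕ l) (l ⊕ l) K :=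
      { toFun := fun x => fromBlocks x 0 0 xᵀ
        map_add' := fun x y => by rw [fromBlocks_add, add_zero, transpose_add]
        map_smul' := fun c x => by rw [RingHom.id_apply, fromBlocks_smul, smul_zero, transpose_smul] }
    have hL : ∀ a b : l, L (single a b (1 : K)) = single (inl a) (inl b) (1 : K) + single (inr b) (inr a) 1 := by
      intro a b
      change fromBlocks (single a b (1 : K)) 0 0 (single a b (1 : K))ᵀ = _
      rw [transpose_single, SymplecticSimple.single_inl_inl, SymplecticSimple.single_inr_inr, fromBlocks_add]
      simp
    change L X.toBlocks₁₁ ∈ P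
    have hA : X.toBlocks₁₁ = ∑ a, ∑ b, X.toBlocks₁₁ a b • single a b (1 : K) := by
      simpa only [smul_single, smul_eq_mul, mul_one] using matrix_eq_sum_single X.toBlocks₁₁
    rw [hA, map_sum]
    simp only [map_sum, map_smul, hL]
    -- split off the diagonal terms
    have hsplit : ∀ a : l, ∑ b, X.toBlocks₁₁ a b • (single (inl a) (inl b) (1 : K) + single (inr b) (inr a) 1)
        = X.toBlocks₁₁ a a • (single (inl a) (inl a) (1 : K) + single (inr a) (inr a) 1)
          + ∑ b ∈ Finset.univ.erase a, X.toBlocks₁₁ a b • (single (inl a) (inl b) (1 : K) + single (inr b) (inr a) 1) :=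
      fun a => (Finset.add_sum_erase _ _ (Finset.mem_univ a)).symm
    simp only [hsplit, Finset.sum_add_distrib]
    refine add_mem ?_ (P.sum_mem fun a _ => P.sum_mem fun b hb => P.smul_mem _ (hQ a b (Finset.ne_of_mem_erase hb).symm))
    -- the diagonal part `Σ_a A_{aa} d_a = Σ_a A_{aa} (d_a - d_{a₀})` since `Σ_a A_{aa} = 0`
    rcases isEmpty_or_nonempty l with hl | ⟨⟨a₀⟩⟩
    · simp
    have hdiag : ∀ a, X.toBlocks₁₁ a a = X (inl a) (inl a) := fun a => rfl
    have e2 : ∑ a, X.toBlocks₁₁ a a • (single (inl a) (inl a) (1 : K) + single (inr a) (inr a) 1)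
        = ∑ a, X.toBlocks₁₁ a a • ((single (inl a) (inl a) (1 : K) + single (inr a) (inr a) 1)
            - (single (inl a₀) (inl a₀) (1 : K) + single (inr a₀) (inr a₀) 1))
          + (∑ a, X.toBlocks₁₁ a a) • (single (inl a₀) (inl a₀) (1 : K) + single (inr a₀) (inr a₀) 1) := by
      rw [Finset.sum_smul, ← Finset.sum_add_distrib]
      refine Finset.sum_congr rfl fun a _ => ?_
      rw [smul_sub, sub_add_cancel]
    simp only [hdiag] at e2 ⊢
    rw [e2, htrA, zero_smul, add_zero]
    exact P.sum_mem fun a _ => P.smul_mem _ (hD a a₀)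
  · -- the block `B`: `2(0 B; 0 0) = (0 B+Bᵀ; 0 0) = Σ B_{ab} (E_{ab'} + E_{ba'})`
    let L : Matrix l l K →ₗ[K] Matrix (l ⊕ l) (l ⊕ l) K :=
      { toFun := fun x => fromBlocks 0 x 0 0
        map_add' := fun x y => by rw [fromBlocks_add, add_zero]
        map_smul' := fun c x => by rw [RingHom.id_apply, fromBlocks_smul, smul_zero] }
    have hL : ∀ a b : l, L (single a b (1 : K) + single b a 1) ∈ P := by
      intro a b
      change fromBlocks 0 (single a b (1 : K) + single b a 1) 0 0 ∈ P
      have e' : fromBlocks (0 : Matrix l l K) (single a b (1 : K) + single b a 1) 0 (0 : Matrix l l K) =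
          single (inl a) (inr b) (1 : K) + single (inl b) (inr a) 1 := by
        rw [SymplecticSimple.single_inl_inr, SymplecticSimple.single_inl_inr, fromBlocks_add]
        simp
      rw [e']
      exact hB a b
    refine hPsmul h2 ?_
    have e2 : (2 : K) • fromBlocks (0 : Matrix l l K) X.toBlocks₁₂ 0 0 = L (X.toBlocks₁₂ + X.toBlocks₁₂ᵀ) := by
      rw [hBB, ← two_smul K X.toBlocks₁₂, map_smul]
      rfl
    rw [e2, SymplecticSimple.add_transpose_eq_sum_smul, map_sum]
    refine P.sum_mem fun a _ => ?_
    rw [map_sum]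
    refine P.sum_mem fun b _ => ?_
    rw [map_smul]
    exact P.smul_mem _ (hL a b)
  · -- the block `C`: `2(0 0; C 0) = Σ C_{ab} (E_{a'b} + E_{b'a})`
    let L : Matrix l l K →ₗ[K] Matrix (l ⊕ l) (l ⊕ l) K :=
      { toFun := fun x => fromBlocks 0 0 x 0
        map_add' := fun x y => by rw [fromBlocks_add, add_zero]
        map_smul' := fun c x => by rw [RingHom.id_apply, fromBlocks_smul, smul_zero] }
    have hL : ∀ a b : l, L (single a b (1 : K) + single b a 1) ∈ P := by
      intro a b
      change fromBlocks 0 0 (single a b (1 : K) + single b a 1) 0 ∈ P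
      have e' : fromBlocks (0 : Matrix l l K) 0 (single a b (1 : K) + single b a 1) (0 : Matrix l l K) =
          single (inr a) (inl b) (1 : K) + single (inr b) (inl a) 1 := by
        rw [SymplecticSimple.single_inr_inl, SymplecticSimple.single_inr_inl, fromBlocks_add]
        simp
      rw [e']
      exact hC a b
    refine hPsmul h2 ?_
    have e2 : (2 : K) • fromBlocks (0 : Matrix l l K) 0 X.toBlocks₂₁ 0 = L (X.toBlocks₂₁ + X.toBlocks₂₁ᵀ) := by
      rw [hCC, ← two_smul K X.toBlocks₂₁, map_smul]
      rfl
    rw [e2, SymplecticSimple.add_transpose_eq_sum_smul, map_sum]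
    refine P.sum_mem fun a _ => ?_
    rw [map_sum]
    refine P.sum_mem fun b _ => ?_
    rw [map_smul]
    exact P.smul_mem _ (hL a b)

/-- **Generation**: if `P` is stable under `ad 𝔬(2l)` (`2 ≠ 0`, `|l| ≥ 2`) and contains ONE `E_{uu'}` (the highest weight
vector `2ε_u` of `Sym²`), then `P` contains every traceless self-adjoint matrix: `[m(E_{vu}), E_{uu'}] = E_{uv'} + E_{vu'}`,
`[m(E_{vu}), E_{uv'} + E_{vu'}] = 2E_{vv'}`, `[p_{ab}, E_{aa'}] = -(E_{ab} + E_{b'a'})`, `[p_{av}, E_{av} + E_{v'a'}] = -2E_{v'v}`,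
`[m(E_{ab}), E_{a'a}] = -(E_{a'b} + E_{b'a})`, `[p_{ab}, E_{ab'} + E_{ba'}] = d_a - d_b`, then `mem_of_forall_units_mem`.
[cite: Humphreys1972, §1.2, §20.2 (standard cyclic modules: a maximal vector generates)] [cite: LooijengaLunts1997, Appendix (7.5), p. 28 L89 ("The summands are irreducible")] -/
theorem mem_of_single_inl_inr_mem (h2 : (2 : K) ≠ 0) (h1 : 1 < Fintype.card l)
    (hP : ∀ ⦃Y m : Matrix (l ⊕ l) (l ⊕ l) K⦄, Y ∈ typeD l K → m ∈ P → Y * m - m * Y ∈ P)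
    {u : l} (hu : single (inl u) (inr u) (1 : K) ∈ P)
    {X : Matrix (l ⊕ l) (l ⊕ l) K} (hX : (JD l K).IsSelfAdjoint X) (htr : Matrix.trace X = 0) : X ∈ P := by
  have hPsmul : ∀ {c : K} {m : Matrix (l ⊕ l) (l ⊕ l) K}, c ≠ 0 → c • m ∈ P → m ∈ P :=
    fun hc hm => (P.smul_mem_iff hc).1 hm
  -- all `E_{vv'}`
  have hE : ∀ v : l, single (inl v) (inr v) (1 : K) ∈ P := by
    intro v
    by_cases hvu : v = u
    · rw [hvu]; exact hu
    · have hb := hP (OrthogonalSimpleTypeD.single_inl_inl_sub_single_inr_inr_mem_typeD (R := K) v u) hu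
      rw [msub_comm_single_inl_inr u v] at hb
      have h := hP (OrthogonalSimpleTypeD.single_inl_inl_sub_single_inr_inr_mem_typeD (R := K) v u) hb
      rw [msub_comm_single_inl_inr_add (Ne.symm hvu)] at h
      exact hPsmul h2 h
  -- all `E_{ab'} + E_{ba'}`
  have hB : ∀ a b : l, single (inl a) (inr b) (1 : K) + single (inl b) (inr a) 1 ∈ P := by
    intro a b
    have h := hP (OrthogonalSimpleTypeD.single_inl_inl_sub_single_inr_inr_mem_typeD (R := K) b a) (hE a)
    rwa [msub_comm_single_inl_inr a b] at h
  -- all `E_{ab} + E_{b'a'}`, `a ≠ b`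
  have hQ : ∀ a b : l, a ≠ b → single (inl a) (inl b) (1 : K) + single (inr b) (inr a) 1 ∈ P := by
    intro a b hab
    have h := hP (OrthogonalSimpleTypeD.single_inr_inl_sub_mem_typeD (R := K) a b) (hE a)
    rw [psub_comm_single_inl_inr hab, P.neg_mem_iff] at h
    exact h
  -- all `E_{v'v}`
  have hE' : ∀ v : l, single (inr v) (inl v) (1 : K) ∈ P := by
    intro v
    obtain ⟨a, hav⟩ := Fintype.exists_ne_of_one_lt_card h1 v
    have h := hP (OrthogonalSimpleTypeD.single_inr_inl_sub_mem_typeD (R := K) a v) (hQ a v hav)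
    rw [psub_comm_single_inl_inl_add hav, P.neg_mem_iff] at h
    exact hPsmul h2 h
  -- all `E_{a'b} + E_{b'a}`
  have hC : ∀ a b : l, single (inr a) (inl b) (1 : K) + single (inr b) (inl a) 1 ∈ P := by
    intro a b
    have h := hP (OrthogonalSimpleTypeD.single_inl_inl_sub_single_inr_inr_mem_typeD (R := K) a b) (hE' a)
    rw [msub_comm_single_inr_inl a b, P.neg_mem_iff] at h
    exact h
  -- all `d_a - d_b`
  have hD : ∀ a b : l, (single (inl a) (inl a) (1 : K) + single (inr a) (inr a) 1)
      - (single (inl b) (inl b) (1 : K) + single (inr b) (inr b) 1) ∈ P := by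
    intro a b
    by_cases hab : a = b
    · rw [hab, sub_self]; exact P.zero_mem
    · have h := hP (OrthogonalSimpleTypeD.single_inr_inl_sub_mem_typeD (R := K) a b) (hB a b)
      rwa [psub_comm_single_inl_inr_add hab] at h
  exact mem_of_forall_units_mem h2 hQ hD hB hC hX htr

/-- **The elementary core**: for `2 ≠ 0`, `|l| ≠ 0` in `K` and `|l| ≥ 2`, a `K`-subspace `P` of TRACELESS `s`-SELF-ADJOINT
matrices (`s = (0 I; I 0)`) that is stable under `m ↦ Ym - mY` for all `Y ∈ 𝔬(2l, K)` is `0` or contains every traceless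
self-adjoint matrix — the summand `𝔤_+(U)` of Looijenga–Lunts (7.5) is irreducible under `𝔞𝔲𝔱(U) = 𝔬(2l)` (split even
orthogonal form; `Sym²₀` of the defining representation of `D_ℓ`).  A member with no usable entry is scalar, `X = c·1`,
and then `tr X = 2|l|c = 0` forces `X = 0` — this is where `|l| ≠ 0` in `K` enters (for `char K ∣ 2|l|` the identity IS
traceless and spans a stable line). [cite: LooijengaLunts1997, Appendix (7.5), p. 28 L89 ("The summands are irreducible")] [cite: Humphreys1972, §19.2, §20.1–§20.2] -/
theorem eq_bot_or_forall_mem_of_forall_comm_mem (h2 : (2 : K) ≠ 0) (hl : ((Fintype.card l : ℕ) : K) ≠ 0)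
    (h1 : 1 < Fintype.card l)
    (hP : ∀ ⦃Y m : Matrix (l ⊕ l) (l ⊕ l) K⦄, Y ∈ typeD l K → m ∈ P → Y * m - m * Y ∈ P)
    (hPS : ∀ ⦃m : Matrix (l ⊕ l) (l ⊕ l) K⦄, m ∈ P → (JD l K).IsSelfAdjoint m)
    (hPT : ∀ ⦃m : Matrix (l ⊕ l) (l ⊕ l) K⦄, m ∈ P → Matrix.trace m = 0) :
    P = ⊥ ∨ ∀ ⦃X : Matrix (l ⊕ l) (l ⊕ l) K⦄, (JD l K).IsSelfAdjoint X → Matrix.trace X = 0 → X ∈ P := by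
  by_cases hbot : P = ⊥
  · exact Or.inl hbot
  right
  obtain ⟨X, hXP, hX0⟩ := (Submodule.ne_bot_iff P).1 hbot
  have hX := hPS hXP
  -- Step 1: some `E_{uu'}` lies in `P`
  have hunit : ∃ u : l, single (inl u) (inr u) (1 : K) ∈ P := by
    by_cases hC : ∃ a b : l, a ≠ b ∧ (X (inr b) (inl a) ≠ 0 ∨ X (inr b) (inl b) ≠ 0 ∨ X (inr a) (inl a) ≠ 0)
    · obtain ⟨a, b, hab, hne⟩ := hC
      exact exists_single_inl_inr_mem_of_lowerLeft h2 hP hX hXP hab hne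
    by_cases hB : ∃ a b : l, a ≠ b ∧ (X (inl a) (inr b) ≠ 0 ∨ X (inl a) (inr a) ≠ 0 ∨ X (inl b) (inr b) ≠ 0)
    · obtain ⟨a, b, hab, hne⟩ := hB
      exact exists_single_inl_inr_mem_of_upperRight h2 hP hPS hXP hab hne
    by_cases hA : ∃ a b : l, a ≠ b ∧ (X (inl a) (inl b) ≠ 0 ∨ X (inl b) (inl a) ≠ 0 ∨ X (inl a) (inl a) ≠ X (inl b) (inl b))
    · obtain ⟨a, b, hab, hne⟩ := hA
      exact exists_single_inl_inr_mem_of_upperLeft h2 hP hPS hXP hab hne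
    push Not at hC hB hA
    -- now `X` is the scalar `c·1`, `c = X_{a₀a₀}`; its trace `2|l|c` vanishes, so `X = 0`: contradiction
    exfalso
    apply hX0
    obtain ⟨a₀⟩ : Nonempty l := Fintype.card_pos_iff.1 (by omega)
    have hdiag : ∀ a : l, X (inl a) (inl a) = X (inl a₀) (inl a₀) := by
      intro a
      by_cases ha : a = a₀
      · rw [ha]
      · exact (hA a a₀ ha).2.2
    have hc : X (inl a₀) (inl a₀) = 0 := by
      have htr := hPT hXP
      rw [trace_eq_two_mul_sum hX] at htr
      simp only [hdiag, Finset.sum_const, Finset.card_univ, nsmul_eq_mul] at htr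
      rcases mul_eq_zero.1 htr with h | h
      · exact absurd h h2
      · exact (mul_eq_zero.1 h).resolve_left hl
    ext p q
    rw [Matrix.zero_apply]
    rcases p with a | a <;> rcases q with b | b
    · by_cases hab : a = b
      · subst hab; rw [hdiag, hc]
      · exact (hA a b hab).1
    · by_cases hab : a = b
      · subst hab
        obtain ⟨b, hba⟩ := Fintype.exists_ne_of_one_lt_card h1 a
        exact (hB a b (Ne.symm hba)).2.1
      · exact (hB a b hab).1
    · by_cases hab : a = b
      · subst hab
        obtain ⟨b, hba⟩ := Fintype.exists_ne_of_one_lt_card h1 a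
        exact (hC a b (Ne.symm hba)).2.2
      · exact (hC b a (Ne.symm hab)).1
    · rw [apply_inr_inr hX]
      by_cases hba : b = a
      · subst hba; rw [hdiag, hc]
      · exact (hA b a hba).1
  -- Step 2: generation
  obtain ⟨u, hu⟩ := hunit
  intro Y hY hYtr
  exact mem_of_single_inl_inr_mem h2 h1 hP hu hY hYtr

end span

/-! ### §7 `Sym²₀` is an irreducible `𝔬(2l)`-module: the subspace statement -/

/-- Membership in `𝔤_+ = sym_s ∩ 𝔰𝔩`: `X ∈ selfAdjointMatricesSubmodule s ⊓ ker tr ↔ X` is `s`-self-adjoint and traceless.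
[cite: LooijengaLunts1997, Appendix (7.5), p. 28 L80–L84] -/
theorem mem_selfAdjoint_inf_ker_trace_iff (X : Matrix (l ⊕ l) (l ⊕ l) K) :
    X ∈ selfAdjointMatricesSubmodule (JD l K) ⊓ LinearMap.ker (Matrix.traceLinearMap (l ⊕ l) K K)
      ↔ (JD l K).IsSelfAdjoint X ∧ Matrix.trace X = 0 := by
  rw [Submodule.mem_inf, mem_selfAdjointMatricesSubmodule, LinearMap.mem_ker, Matrix.traceLinearMap_apply]

/-- **Looijenga–Lunts (7.5), "the summands are irreducible" — the summand `𝔤_+(U)` for a split even orthogonal form,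
in matrices**: for `s = (0 I; I 0)` of size `2|l|`, `2 ≠ 0`, `|l| ≠ 0` in `K` and `|l| ≥ 2`, every `K`-subspace
`P ⊆ 𝔤_+ = {X : Xᵀs = sX, tr X = 0}` that is stable under `X ↦ [A, X] = AX - XA` for all `A ∈ 𝔬(2l, K) = typeD l K` is
`⊥` or all of `𝔤_+`.  (`|l| = 1`: `𝔤_+` of the hyperbolic plane is reducible — the inner product plane, excluded in (7.5),
cf. `SplitOrthogonalFourIdeals.lean` §6; `|l| = 2`: TRUE, the dimension-`4` exception of (7.5) concerns `𝔤_-` only.)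
[cite: LooijengaLunts1997, Appendix (7.5), p. 28 L86–L90] [cite: Humphreys1972, §19.2, §20.1–§20.2 (maximal vector of weight 2ε₁)] -/
theorem eq_bot_or_eq_of_forall_comm_mem (h2 : (2 : K) ≠ 0) (hl : ((Fintype.card l : ℕ) : K) ≠ 0)
    (h1 : 1 < Fintype.card l) {P : Submodule K (Matrix (l ⊕ l) (l ⊕ l) K)}
    (hle : P ≤ selfAdjointMatricesSubmodule (JD l K) ⊓ LinearMap.ker (Matrix.traceLinearMap (l ⊕ l) K K))
    (hP : ∀ A ∈ typeD l K, ∀ X ∈ P, A * X - X * A ∈ P) :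
    P = ⊥ ∨ P = selfAdjointMatricesSubmodule (JD l K) ⊓ LinearMap.ker (Matrix.traceLinearMap (l ⊕ l) K K) := by
  have hPS : ∀ ⦃m : Matrix (l ⊕ l) (l ⊕ l) K⦄, m ∈ P → (JD l K).IsSelfAdjoint m :=
    fun m hm => ((mem_selfAdjoint_inf_ker_trace_iff m).1 (hle hm)).1
  have hPT : ∀ ⦃m : Matrix (l ⊕ l) (l ⊕ l) K⦄, m ∈ P → Matrix.trace m = 0 :=
    fun m hm => ((mem_selfAdjoint_inf_ker_trace_iff m).1 (hle hm)).2
  rcases eq_bot_or_forall_mem_of_forall_comm_mem h2 hl h1 (fun Y m hY hm => hP Y hY m hm) hPS hPT with h | h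
  · exact Or.inl h
  · right
    refine le_antisymm hle fun X hX => ?_
    obtain ⟨hXs, hXt⟩ := (mem_selfAdjoint_inf_ker_trace_iff X).1 hX
    exact h hXs hXt

/-- The same over a field of characteristic `0` (the setting of Looijenga–Lunts: `K = ℚ, ℝ, ℂ`), `|l| ≥ 2`.
[cite: LooijengaLunts1997, Appendix (7.5), p. 28 L86–L90] -/
theorem eq_bot_or_eq_of_forall_comm_mem_of_charZero [CharZero K] (h1 : 1 < Fintype.card l)
    {P : Submodule K (Matrix (l ⊕ l) (l ⊕ l) K)}
    (hle : P ≤ selfAdjointMatricesSubmodule (JD l K) ⊓ LinearMap.ker (Matrix.traceLinearMap (l ⊕ l) K K))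
    (hP : ∀ A ∈ typeD l K, ∀ X ∈ P, A * X - X * A ∈ P) :
    P = ⊥ ∨ P = selfAdjointMatricesSubmodule (JD l K) ⊓ LinearMap.ker (Matrix.traceLinearMap (l ⊕ l) K K) :=
  eq_bot_or_eq_of_forall_comm_mem two_ne_zero (Nat.cast_ne_zero.2 (by omega)) h1 hle hP

/-- `𝔤_+` is non-zero for `l` non-empty: `E_{uu'} ∈ 𝔤_+` and `E_{uu'} ≠ 0` — so "⊥ or everything" is a genuine
irreducibility statement. [cite: LooijengaLunts1997, Appendix (7.5), p. 28] -/
theorem single_inl_inr_mem_selfAdjoint_inf_ker_trace (u : l) :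
    single (inl u) (inr u) (1 : K) ∈ selfAdjointMatricesSubmodule (JD l K) ⊓ LinearMap.ker (Matrix.traceLinearMap (l ⊕ l) K K)
      ∧ (single (inl u) (inr u) (1 : K) : Matrix (l ⊕ l) (l ⊕ l) K) ≠ 0 := by
  refine ⟨(mem_selfAdjoint_inf_ker_trace_iff _).2 ⟨single_inl_inr_isSelfAdjoint u, ?_⟩, fun h => ?_⟩
  · rw [Matrix.trace_single_eq_of_ne]
    exact inl_ne_inr
  · have := congrFun (congrFun h (inl u)) (inr u)
    rw [single_apply_same, Matrix.zero_apply] at this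
    exact one_ne_zero this

/-! ### §8 Basis-free transport (rider A1-175): `𝔤_+(U) = sym_B(U) ∩ 𝔰𝔩(U)` is `ad(𝔰𝔬(U, B))`-irreducible for a split even form

As in `OrthogonalAlgebraSimple.eq_bot_or_eq_of_core` (row A1-171) the matrix core is transported through the algebra
isomorphism `X ↦ [X]_b` (`LinearMap.toMatrix b b`): `X ∈ sym_B ↔ [X]_bᵀ G = G [X]_b` (row A1-166's bridge
`SymplecticAlgebraSimple.mem_selfAdjointSubmodule_iff_isSelfAdjoint_toMatrix`), `tr X = tr [X]_b`
(`LinearMap.trace_eq_matrix_trace`), and `[a, X] ↦ [a]_b[X]_b - [X]_b[a]_b`. -/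

section Transport

variable {V : Type*} [AddCommGroup V] [Module K V] {B : LinearMap.BilinForm K V}

open Module in
/-- **Transport of a matrix core for `𝔤_+`**: if, in the coordinates of a basis `b` (Gram matrix `G`), every `K`-subspace of
traceless `G`-self-adjoint matrices stable under `m ↦ Ym - mY` (`Y` `G`-skew) is `0` or everything, then every
`ad(𝔰𝔬(U, B))`-stable `K`-subspace of `𝔤_+(U) = B.selfAdjointSubmodule ⊓ ker tr` is `⊥` or `𝔤_+(U)`.
[cite: LooijengaLunts1997, Appendix Lemma (7.5), p. 28 L86–L90] [cite: Humphreys1972, §1.2, p. 3] -/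
theorem eq_bot_or_eq_of_core {n : Type*} [Fintype n] [DecidableEq n] (b : Basis n K V)
    (core : ∀ P' : Submodule K (Matrix n n K),
      (∀ ⦃Y m : Matrix n n K⦄, (LinearMap.BilinForm.toMatrix b B).IsSkewAdjoint Y → m ∈ P' → Y * m - m * Y ∈ P') →
      (∀ ⦃m : Matrix n n K⦄, m ∈ P' → (LinearMap.BilinForm.toMatrix b B).IsSelfAdjoint m) →
      (∀ ⦃m : Matrix n n K⦄, m ∈ P' → Matrix.trace m = 0) →
      P' = ⊥ ∨ ∀ ⦃X : Matrix n n K⦄, (LinearMap.BilinForm.toMatrix b B).IsSelfAdjoint X → Matrix.trace X = 0 → X ∈ P')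
    {P : Submodule K (Module.End K V)} (hP : P ≤ B.selfAdjointSubmodule ⊓ LinearMap.ker (LinearMap.trace K V))
    (hstab : ∀ a ∈ B.skewAdjointSubmodule, ∀ x ∈ P, ⁅a, x⁆ ∈ P) :
    P = ⊥ ∨ P = B.selfAdjointSubmodule ⊓ LinearMap.ker (LinearMap.trace K V) := by
  classical
  have hsk : ∀ X : Module.End K V,
      X ∈ B.skewAdjointSubmodule ↔ (LinearMap.BilinForm.toMatrix b B).IsSkewAdjoint (LinearMap.toMatrix b b X) :=
    fun X ↦ SymplecticAlgebraSimple.mem_skewAdjointSubmodule_iff_isSkewAdjoint_toMatrix b B X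
  have hmem : ∀ X : Module.End K V, X ∈ B.selfAdjointSubmodule ⊓ LinearMap.ker (LinearMap.trace K V) ↔
      (LinearMap.BilinForm.toMatrix b B).IsSelfAdjoint (LinearMap.toMatrix b b X)
        ∧ Matrix.trace (LinearMap.toMatrix b b X) = 0 := by
    intro X
    rw [Submodule.mem_inf, SymplecticAlgebraSimple.mem_selfAdjointSubmodule_iff_isSelfAdjoint_toMatrix b B X,
      LinearMap.mem_ker, LinearMap.trace_eq_matrix_trace K b X]
  let Φ : Module.End K V ≃ₗ[K] Matrix n n K := LinearMap.toMatrix b b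
  have hΦmul : ∀ X Y : Module.End K V, Φ (X * Y) = Φ X * Φ Y := fun X Y ↦ LinearMap.toMatrix_mul b X Y
  let P' : Submodule K (Matrix n n K) := P.map (Φ : Module.End K V →ₗ[K] Matrix n n K)
  have hP'mem : ∀ m, m ∈ P' ↔ Φ.symm m ∈ P := fun m ↦ Submodule.mem_map_equiv (e := Φ) (p := P)
  have hP'sa : ∀ ⦃m : Matrix n n K⦄, m ∈ P' → (LinearMap.BilinForm.toMatrix b B).IsSelfAdjoint m := by
    intro m hm
    have h := ((hmem _).1 (hP ((hP'mem m).1 hm))).1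
    rwa [LinearEquiv.apply_symm_apply] at h
  have hP'tr : ∀ ⦃m : Matrix n n K⦄, m ∈ P' → Matrix.trace m = 0 := by
    intro m hm
    have h := ((hmem _).1 (hP ((hP'mem m).1 hm))).2
    rwa [LinearEquiv.apply_symm_apply] at h
  have hP'stab : ∀ ⦃Y m : Matrix n n K⦄, (LinearMap.BilinForm.toMatrix b B).IsSkewAdjoint Y → m ∈ P' →
      Y * m - m * Y ∈ P' := by
    intro Y m hY hm
    have hY' : Φ.symm Y ∈ B.skewAdjointSubmodule := by
      rw [hsk, LinearEquiv.apply_symm_apply]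
      exact hY
    have h := hstab _ hY' _ ((hP'mem m).1 hm)
    rw [Ring.lie_def] at h
    rw [hP'mem]
    have hsymm_eq : Φ.symm (Y * m - m * Y) = Φ.symm Y * Φ.symm m - Φ.symm m * Φ.symm Y := by
      apply Φ.injective
      rw [LinearEquiv.apply_symm_apply, map_sub, hΦmul, hΦmul, LinearEquiv.apply_symm_apply,
        LinearEquiv.apply_symm_apply]
    rw [hsymm_eq]
    exact h
  by_cases hbot : P = ⊥
  · exact Or.inl hbot
  right
  obtain ⟨x, hxP, hx0⟩ := (Submodule.ne_bot_iff P).1 hbot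
  have hX : Φ x ∈ P' := (hP'mem _).2 (by rw [LinearEquiv.symm_apply_apply]; exact hxP)
  have hX0 : Φ x ≠ 0 := fun h ↦ hx0 ((LinearEquiv.map_eq_zero_iff Φ).1 h)
  rcases core P' hP'stab hP'sa hP'tr with h0 | hall
  · exact absurd ((Submodule.mem_bot K).1 (h0 ▸ hX)) hX0
  refine le_antisymm hP fun a ha ↦ ?_
  obtain ⟨ha1, ha2⟩ := (hmem a).1 ha
  have h := hall ha1 ha2
  rw [hP'mem, LinearEquiv.symm_apply_apply] at h
  exact h

open Module in
/-- **Split even form, any field with `2 ≠ 0` and `|m| ≠ 0`** (`|m| ≥ 2`): if `B` has a basis with Gram matrix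
`JD m K = (0 I; I 0)`, then every `ad(𝔰𝔬(U, B))`-stable `K`-subspace of `𝔤_+(U) = sym_B(U) ∩ 𝔰𝔩(U)` is `⊥` or `𝔤_+(U)`:
"the summands are irreducible" for the summand `𝔤_+(U)`, orthogonal `U` of even dimension `≥ 4` with a split form
(e.g. `V ⊕ V^*` with `q(x, ξ) = ξ(x)` of §3 of the paper, over `ℚ`, `ℝ` or `ℂ`).
[cite: LooijengaLunts1997, Appendix Lemma (7.5), p. 28 L86–L90; Humphreys1972, §1.2 p. 4, §20.1–§20.2] -/
theorem eq_bot_or_eq_of_forall_lie_mem_of_toMatrix_eq_JD [NeZero (2 : K)] {m : Type*} [Fintype m] [DecidableEq m]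
    (b : Basis (m ⊕ m) K V) (hb : LinearMap.BilinForm.toMatrix b B = JD m K) (hm : ((Fintype.card m : ℕ) : K) ≠ 0)
    (h1 : 1 < Fintype.card m)
    {P : Submodule K (Module.End K V)} (hP : P ≤ B.selfAdjointSubmodule ⊓ LinearMap.ker (LinearMap.trace K V))
    (hstab : ∀ a ∈ B.skewAdjointSubmodule, ∀ x ∈ P, ⁅a, x⁆ ∈ P) :
    P = ⊥ ∨ P = B.selfAdjointSubmodule ⊓ LinearMap.ker (LinearMap.trace K V) := by
  refine eq_bot_or_eq_of_core b (fun P' hst hsa htr ↦ ?_) hP hstab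
  rw [hb] at hst hsa ⊢
  exact eq_bot_or_forall_mem_of_forall_comm_mem (P := P') (NeZero.ne 2) hm h1
    (fun Y n hY hn ↦ hst ((OrthogonalSimpleTypeD.isSkewAdjoint_JD_iff_mem_typeD Y).2 hY) hn) hsa htr

open Module in
/-- **EVEN dimension `2m ≥ 4` over an algebraically closed field** (`2 ≠ 0`, `m ≠ 0` in `K`; e.g. `K = ℂ`): for a
non-degenerate symmetric `B`, the traceless `B`-self-adjoint operators `𝔤_+(U)` have no proper non-zero
`ad(𝔰𝔬(U, B))`-stable subspace — through row A1-171's hyperbolic basis `exists_basis_toMatrix_eq_JD`.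
[cite: LooijengaLunts1997, Appendix Lemma (7.5), p. 28 L86–L90 ("The summands are irreducible")] [cite: Humphreys1972, §20.1–§20.2] -/
theorem eq_bot_or_eq_of_forall_lie_mem_of_even [IsAlgClosed K] [NeZero (2 : K)] [FiniteDimensional K V]
    (hB : B.Nondegenerate) (hs : ∀ u v : V, B u v = B v u) {m : ℕ} (hdim : finrank K V = m + m) (hmK : (m : K) ≠ 0)
    (h2 : 2 ≤ m)
    {P : Submodule K (Module.End K V)} (hP : P ≤ B.selfAdjointSubmodule ⊓ LinearMap.ker (LinearMap.trace K V))
    (hstab : ∀ a ∈ B.skewAdjointSubmodule, ∀ x ∈ P, ⁅a, x⁆ ∈ P) :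
    P = ⊥ ∨ P = B.selfAdjointSubmodule ⊓ LinearMap.ker (LinearMap.trace K V) := by
  obtain ⟨b, hb⟩ := OrthogonalAlgebraSimple.exists_basis_toMatrix_eq_JD hB hs hdim
  refine eq_bot_or_eq_of_forall_lie_mem_of_toMatrix_eq_JD b hb ?_ ?_ hP hstab
  · rwa [Fintype.card_fin]
  · rwa [Fintype.card_fin]

open Module in
/-- The same in characteristic `0` (the paper's `K = ℂ`): even `dim U = 2m ≥ 4`, `B` non-degenerate symmetric.
[cite: LooijengaLunts1997, Appendix Lemma (7.5), p. 28 L86–L90] -/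
theorem eq_bot_or_eq_of_forall_lie_mem_of_even_of_charZero [IsAlgClosed K] [CharZero K] [FiniteDimensional K V]
    (hB : B.Nondegenerate) (hs : ∀ u v : V, B u v = B v u) {m : ℕ} (hdim : finrank K V = m + m) (h2 : 2 ≤ m)
    {P : Submodule K (Module.End K V)} (hP : P ≤ B.selfAdjointSubmodule ⊓ LinearMap.ker (LinearMap.trace K V))
    (hstab : ∀ a ∈ B.skewAdjointSubmodule, ∀ x ∈ P, ⁅a, x⁆ ∈ P) :
    P = ⊥ ∨ P = B.selfAdjointSubmodule ⊓ LinearMap.ker (LinearMap.trace K V) :=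
  eq_bot_or_eq_of_forall_lie_mem_of_even hB hs hdim (Nat.cast_ne_zero.2 (by omega)) h2 hP hstab

open Module in
/-- Non-vacuity: with a basis of Gram matrix `JD m K` (`m` non-empty) the subspace `𝔤_+(U)` is non-zero — it contains
the pull-back of `E_{uu'}`. [cite: LooijengaLunts1997, Appendix Lemma (7.5), p. 28] -/
theorem exists_ne_zero_mem_selfAdjoint_inf_ker_trace {m : Type*} [Fintype m] [DecidableEq m]
    (b : Basis (m ⊕ m) K V) (hb : LinearMap.BilinForm.toMatrix b B = JD m K) (u : m) :
    ∃ x : Module.End K V, x ≠ 0 ∧ x ∈ B.selfAdjointSubmodule ⊓ LinearMap.ker (LinearMap.trace K V) := by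
  obtain ⟨hmem, hne⟩ := single_inl_inr_mem_selfAdjoint_inf_ker_trace (K := K) (l := m) u
  rw [mem_selfAdjoint_inf_ker_trace_iff] at hmem
  refine ⟨(LinearMap.toMatrix b b).symm (single (inl u) (inr u) (1 : K)), fun h ↦ hne ?_, ?_⟩
  · rw [← (LinearMap.toMatrix b b).apply_symm_apply (single (inl u) (inr u) (1 : K)), h, map_zero]
  · rw [Submodule.mem_inf, SymplecticAlgebraSimple.mem_selfAdjointSubmodule_iff_isSelfAdjoint_toMatrix b B,
      LinearMap.mem_ker, LinearMap.trace_eq_matrix_trace K b, LinearEquiv.apply_symm_apply, hb]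
    exact hmem

end Transport

end Literature.Algebra.Lie.OrthogonalSelfAdjointTypeD
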